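import Literature.NumberTheory.LFunctions.NicolasHCCriterionRH
import Literature.NumberTheory.LFunctions.SuperiorHighlyComposite
import HarnessLib

/-!
# RH-CONDITIONAL · Nicolas 2022, Thm. 1.1 (i) in asymptotic form: under RH, `log d(n)/log 2 ≤ F(log n) − R(log n) − 5.12 √(log n)/log³ log n + 1.52 log^{β₃} n/log log n` (1.8) holds for ALL large `n`; nothing here bears on the truth of RH

Literature-typing tranche `rh-lit-broughan-1` (Broughan vol. 3 ch. 2; PRIMARY: J.-L. Nicolas, *Highly
composite numbers and the Riemann hypothesis*, Ramanujan J. 57 (2022) 507–550, Thm. 1.1 (i),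
Prop. 4.1 (4.2), §3.2–3.6, §4.3). Everything here is PROVED; no named facts.

The tree fact `Nicolas2022_thm_1_1_i` is the explicit statement "(1.8) for every `n > 183783600`
under RH" (a computation on highly composite numbers closes the finite range, §4.2). This file
proves the asymptotic content: **`Nicolas2022.ineq18_eventually_of_RH : RiemannHypothesis →
∀ᶠ n in atTop, Ineq18 n`.** Architecture (Nicolas §4.1/§4.3, with cruder constants):

* §1 (RH-FREE, from `SuperiorHighlyComposite.lean`): for every `n ≥ 1` and `ξ > 1`,
  `log d(n)/log 2 ≤ log d(N(ξ))/log 2 + (log n − log N(ξ))/log ξ`, `N(ξ) = shcAt ξ` Ramanujan's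
  superior highly composite number of parameter `ε = log 2/log ξ` (`Nicolas2022.log2d_le_shcAt`).
* §2 (RH): at `N = N(ξ)`, `L = log N = θ(ξ) + θ(ξ^{β₂}) + E₃`:
  `log d(N)/log 2 ≤ F(L) − R(L) − 6.5 √ξ/log³ ξ` (`Nicolas2022.log2d_shcAt_le_of_RH`), from
  Prop. 2.12 (2.53) in the tree's form `A(ξ) − R(ξ) ≥ (8 − 4τ − 0.01)√ξ/log³ξ`
  (`prop_2_12_of_RH`), `R` slowly varying (`abs_R_sub_R_le_of_RH`), `A(ξ^{β₂}) > 0`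
  (`eventually_liThetaSubPi_pos_of_riemannHypothesis`) and the concavity of `li`.
* §3: interpolation between consecutive `N(m)`, `N(m+1)` (`|log N(m) − m| ≤ m^{3/5}` under RH):
  `F`, `R` and `√t/log³ t` vary by `o(√ξ/log³ξ)` over such gaps (`F_sub_F_add_le`).
* §4: Cor. 1.2 in asymptotic form under RH — `ineq110_eventually_of_RH` ((1.10)),
  `ineq111_eventually_of_RH` ((1.11): `log d(n)/log 2 ≤ li(log n) + β₂ li(log^{β₂} n)`),
  `log2d_le_F_eventually_of_RH` ((1.12)), `log2d_le_F_sub_R_eventually_of_RH` ((1.13)); the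
  printed explicit ranges (`n > 122522400`, `n ≥ exp(1.56·10¹⁷)`, `n > exp(1.11·10⁴⁰)`, …) are
  the tree fact `Nicolas2022_cor_1_2`.
* §5: `riemannHypothesis_iff_eventually_ineq18_of (h₂ : Nicolas2022_thm_1_1_ii)` — RH ⟺ (1.8)
  eventually, now over the single named fact (ii) (the tree's `riemannHypothesis_iff_eventually_of`
  needed (i) and (ii)); likewise `riemannHypothesis_iff_setOf_not_ineq18_finite_of`.

## References

* J.-L. Nicolas, *Highly composite numbers and the Riemann hypothesis*, Ramanujan J. 57 (2022)
  507–550: Thm. 1.1 (i) (1.8), Cor. 1.2 (1.10)–(1.13), Prop. 4.1 (4.2), Lemma 4.3, Def. 3.5,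
  (3.8), Prop. 3.10. [Nicolas2022HC]
* S. Ramanujan, *Highly composite numbers*, Proc. LMS (2) 14 (1915) 347–409, §§32–33. [Ramanujan1915]
-/

noncomputable section

open Real Filter Set Topology Asymptotics
open scoped Chebyshev

namespace Literature.NumberTheory.LFunctions

namespace Nicolas2022

open RobinLiTheta LiThetaRH

/-! ### §1. `N(ξ)` and the RH-free comparison `d(n)` vs `d(N(ξ))` -/

/-- `N(ξ)`: Ramanujan's superior highly composite number of parameter `ε = log 2/log ξ`
(so that `ξ(N) = 2^{1/ε} = ξ`, Def. 3.9 (3.12)). [cite: Nicolas2022HC, Def. 3.9 (3.12), (3.8)] -/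
def shcAt (ξ : ℝ) : ℕ := shcNumber (Real.log 2 / Real.log ξ)

/-- **`log d(n)/log 2 ≤ log d(N(ξ))/log 2 + (log n − log N(ξ))/log ξ`** for every `n ≥ 1`, `ξ > 1`
(maximality of `N(ξ)` for the parameter `log 2/log ξ`). RH-FREE.
[cite: Nicolas2022HC, Def. 3.5 (3.3) with (3.8), (3.12)] -/
theorem log2d_le_shcAt {n : ℕ} (hn : n ≠ 0) {ξ : ℝ} (hξ : 1 < ξ) :
    log2d n ≤ log2d (shcAt ξ) + (Real.log n - Real.log (shcAt ξ)) / Real.log ξ := by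
  have hl2 : 0 < Real.log 2 := Real.log_pos one_lt_two
  have hl : 0 < Real.log ξ := Real.log_pos hξ
  have h := log_card_divisors_le_of_shcNumber (div_pos hl2 hl) hn
  rw [log2d, log2d, shcAt]
  have e : Real.log ((shcNumber (Real.log 2 / Real.log ξ)).divisors.card) / Real.log 2 +
      (Real.log n - Real.log (shcNumber (Real.log 2 / Real.log ξ))) / Real.log ξ =
      (Real.log ((shcNumber (Real.log 2 / Real.log ξ)).divisors.card) +
        Real.log 2 / Real.log ξ * (Real.log n - Real.log (shcNumber (Real.log 2 / Real.log ξ)))) /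
        Real.log 2 := by
    field_simp
  rw [e]
  exact div_le_div_of_nonneg_right h hl2.le

/-! ### §2. Under RH: (1.8) at `N(ξ)` with room to spare -/

/-- `c log^k x ≤ x^a` eventually (`a > 0`). [folklore] -/
private theorem eventually_mul_log_pow_le_rpow' (c : ℝ) (k : ℕ) {a : ℝ} (ha : 0 < a) :
    ∀ᶠ x : ℝ in atTop, c * Real.log x ^ k ≤ x ^ a := by
  have h1 : (fun x : ℝ ↦ Real.log x ^ (k : ℝ)) =o[atTop] fun x ↦ x ^ a :=
    isLittleO_log_rpow_rpow_atTop k ha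
  have h2 := (h1.const_mul_left c).def one_pos
  filter_upwards [h2, eventually_gt_atTop 1] with x hx hx1
  rw [Real.norm_eq_abs, Real.norm_eq_abs, one_mul, abs_of_nonneg (Real.rpow_nonneg (by linarith) _),
    Real.rpow_natCast] at hx
  exact (le_abs_self _).trans hx

/-- `β₃ < 1/2 < β₂ < 3/5`. [cite: Nicolas2022HC, (1.2)] -/
theorem beta_three_lt_half : beta 3 < 1 / 2 := by
  have hl2 : 0 < Real.log 2 := Real.log_pos one_lt_two
  rw [beta, div_lt_iff₀ hl2]
  have h3 : Real.log (((1 : ℝ) + 1 / (3 : ℕ)) ^ 2) < Real.log 2 := Real.log_lt_log (by positivity) (by norm_num)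
  rw [Real.log_pow] at h3
  push_cast at h3 ⊢
  linarith

/-- The lumped levels `k ≥ 3` of `log N(ξ)` are `≤ ξ^{3/5}/4` once
`8 log ξ/(log 2)² ≤ ξ^{3/5 − β₃}`. [cite: Nicolas2022HC, Prop. 3.10, (3.14)] -/
theorem level_three_log_le {ξ : ℝ} (hξ2 : 2 ≤ ξ)
    (hs : 8 * Real.log ξ ≤ ξ ^ (3 / 5 - beta 3) * Real.log 2 ^ 2) :
    ∑ p ∈ Nat.primesLE ⌊ξ ^ beta 3⌋₊,
        ((shcExponent (Real.log 2 / Real.log ξ) p : ℝ) - 2) * Real.log p ≤ ξ ^ (3 / 5 : ℝ) / 4 := by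
  have hξ0 : 0 < ξ := by linarith
  have hl0 : 0 < Real.log ξ := Real.log_pos (by linarith)
  have hz3 : 0 < ξ ^ beta 3 := Real.rpow_pos_of_pos hξ0 _
  have hl4 : Real.log 4 ≤ 2 := by
    have : Real.log 4 = 2 * Real.log 2 := by
      rw [show (4 : ℝ) = 2 ^ 2 by norm_num, Real.log_pow]; norm_num
    rw [this]; linarith [Real.log_two_lt_d9]
  have hθ3 : θ (ξ ^ beta 3) ≤ 2 * ξ ^ beta 3 :=
    (Chebyshev.theta_le_log4_mul_x hz3.le).trans (by nlinarith)
  have e35c : ξ ^ (3 / 5 : ℝ) = ξ ^ (3 / 5 - beta 3) * ξ ^ beta 3 := by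
    rw [← Real.rpow_add hξ0]; norm_num
  refine (sum_level_three_log_bounds hξ2).2.trans ?_
  rw [e35c, div_mul_eq_mul_div, div_le_iff₀ (by positivity)]
  have h1 := mul_le_mul_of_nonneg_left hθ3 hl0.le
  have h2 := mul_le_mul_of_nonneg_right hs hz3.le
  linarith

/-- `π(n) ≤ n + 1` (crude). [folklore] -/
private theorem primeCounting_le_succ (n : ℕ) : Nat.primeCounting n ≤ n + 1 := by
  rw [← Nat.primesLE_card_eq_primeCounting, Nat.primesLE, Nat.primesBelow]
  exact (Finset.card_filter_le _ _).trans (by simp)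

/-- The lumped levels `k ≥ 3` of `log d(N(ξ))/log 2` are `≤ 0.2 √ξ/log³ ξ` once
`30 log⁴ ξ/log 2 ≤ ξ^{1/2 − β₃}`. [cite: Nicolas2022HC, Prop. 3.10, (3.14)] -/
theorem level_three_log2d_le {ξ : ℝ} (hξ2 : 2 ≤ ξ)
    (hs : 30 * Real.log ξ ^ 4 ≤ ξ ^ (1 / 2 - beta 3) * Real.log 2) :
    (∑ p ∈ Nat.primesLE ⌊ξ ^ beta 3⌋₊,
        (Real.log ((shcExponent (Real.log 2 / Real.log ξ) p : ℝ) + 1) - Real.log 3)) / Real.log 2 ≤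
      0.2 * (Real.sqrt ξ / Real.log ξ ^ 3) := by
  have hξ0 : 0 < ξ := by linarith
  have hξ1 : 1 ≤ ξ := by linarith
  have hl0 : 0 < Real.log ξ := Real.log_pos (by linarith)
  have hl2 : 0 < Real.log 2 := Real.log_pos one_lt_two
  have hb30 : 0 < beta 3 := div_pos (Real.log_pos (by norm_num)) hl2
  have hz3 : 0 < ξ ^ beta 3 := Real.rpow_pos_of_pos hξ0 _
  have e12 : Real.sqrt ξ = ξ ^ (1 / 2 - beta 3) * ξ ^ beta 3 := by
    rw [Real.sqrt_eq_rpow, ← Real.rpow_add hξ0]; norm_num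
  have hπ3 : (Nat.primeCounting ⌊ξ ^ beta 3⌋₊ : ℝ) ≤ 2 * ξ ^ beta 3 := by
    have h1 : (Nat.primeCounting ⌊ξ ^ beta 3⌋₊ : ℝ) ≤ ⌊ξ ^ beta 3⌋₊ + 1 := by
      exact_mod_cast primeCounting_le_succ _
    have h2 : (⌊ξ ^ beta 3⌋₊ : ℝ) ≤ ξ ^ beta 3 := Nat.floor_le hz3.le
    have h3 : (1 : ℝ) ≤ ξ ^ beta 3 := Real.one_le_rpow hξ1 hb30.le
    linarith
  have hlog3 : Real.log (Real.log ξ / Real.log 2 ^ 2 + 1) ≤ 3 * Real.log ξ := by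
    have h1 := Real.log_le_sub_one_of_pos (by positivity : 0 < Real.log ξ / Real.log 2 ^ 2 + 1)
    have h48 : 0.48 ≤ Real.log 2 ^ 2 := by nlinarith [Real.log_two_gt_d9]
    have h2 : Real.log ξ / Real.log 2 ^ 2 ≤ 3 * Real.log ξ := by
      rw [div_le_iff₀ (by positivity)]
      have := mul_le_mul_of_nonneg_left h48 (by positivity : (0 : ℝ) ≤ 3 * Real.log ξ)
      linarith
    linarith
  have hlog0 : 0 ≤ Real.log (Real.log ξ / Real.log 2 ^ 2 + 1) :=
    Real.log_nonneg (by linarith [show (0 : ℝ) ≤ Real.log ξ / Real.log 2 ^ 2 by positivity])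
  rw [div_le_iff₀ hl2]
  refine (sum_level_three_log_succ_bounds hξ2).2.trans ?_
  have step : (Nat.primeCounting ⌊ξ ^ beta 3⌋₊ : ℝ) * Real.log (Real.log ξ / Real.log 2 ^ 2 + 1) ≤
      2 * ξ ^ beta 3 * (3 * Real.log ξ) := mul_le_mul hπ3 hlog3 hlog0 (by positivity)
  refine step.trans ?_
  rw [e12]
  have key : 2 * ξ ^ beta 3 * (3 * Real.log ξ) * Real.log ξ ^ 3 ≤
      0.2 * (ξ ^ (1 / 2 - beta 3) * ξ ^ beta 3) * Real.log 2 := by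
    have h2 := mul_le_mul_of_nonneg_right hs hz3.le
    linarith
  rw [show (0.2 : ℝ) * (ξ ^ (1 / 2 - beta 3) * ξ ^ beta 3 / Real.log ξ ^ 3) * Real.log 2 =
      0.2 * (ξ ^ (1 / 2 - beta 3) * ξ ^ beta 3) * Real.log 2 / Real.log ξ ^ 3 by ring,
    le_div_iff₀ (pow_pos hl0 3)]
  exact key

/-- **Set-up at `N(ξ)` under RH.** There are `K > 0`, `X > 1` such that for `ξ ≥ X`, with
`y = ξ^{β₂}`, `E₃`, `D₃` the lumped levels `k ≥ 3` of `log N(ξ)` and `log d(N(ξ))`: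
`log ξ ≥ 64`; `|θ(ξ) − ξ| ≤ K√ξ log²ξ ≤ ξ^{3/5}/4`; `3y/4 ≤ θ(y) ≤ 5y/4 ≤ ξ^{3/5}/4`;
`0 ≤ E₃ ≤ ξ^{3/5}/4`; `0 ≤ D₃/log 2 ≤ 0.2 √ξ/log³ξ`; `ξ^{3/5} ≤ ξ/40`; and the two decompositions.
[cite: Nicolas2022HC, Prop. 3.10 (3.15)–(3.17), Lemma 3.18 (3.33)–(3.36), §2.1 (2.8)] -/
theorem shcAt_setup_of_RH (hRH : RiemannHypothesis) :
    ∃ K X : ℝ, 0 < K ∧ 1 < X ∧ ∀ ξ : ℝ, X ≤ ξ →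
      64 ≤ Real.log ξ ∧
      |θ ξ - ξ| ≤ K * Real.sqrt ξ * Real.log ξ ^ 2 ∧
      K * Real.sqrt ξ * Real.log ξ ^ 2 ≤ ξ ^ (3 / 5 : ℝ) / 4 ∧
      3 * ξ ^ beta 2 / 4 ≤ θ (ξ ^ beta 2) ∧ θ (ξ ^ beta 2) ≤ 5 * ξ ^ beta 2 / 4 ∧
      5 * ξ ^ beta 2 / 4 ≤ ξ ^ (3 / 5 : ℝ) / 4 ∧
      (0 ≤ ∑ p ∈ Nat.primesLE ⌊ξ ^ beta 3⌋₊,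
          ((shcExponent (Real.log 2 / Real.log ξ) p : ℝ) - 2) * Real.log p ∧
        ∑ p ∈ Nat.primesLE ⌊ξ ^ beta 3⌋₊,
          ((shcExponent (Real.log 2 / Real.log ξ) p : ℝ) - 2) * Real.log p ≤ ξ ^ (3 / 5 : ℝ) / 4) ∧
      (0 ≤ (∑ p ∈ Nat.primesLE ⌊ξ ^ beta 3⌋₊,
          (Real.log ((shcExponent (Real.log 2 / Real.log ξ) p : ℝ) + 1) - Real.log 3)) / Real.log 2 ∧
        (∑ p ∈ Nat.primesLE ⌊ξ ^ beta 3⌋₊,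
          (Real.log ((shcExponent (Real.log 2 / Real.log ξ) p : ℝ) + 1) - Real.log 3)) / Real.log 2 ≤
          0.2 * (Real.sqrt ξ / Real.log ξ ^ 3)) ∧
      ξ ^ (3 / 5 : ℝ) ≤ ξ / 40 ∧
      Real.log (shcAt ξ) = θ ξ + θ (ξ ^ beta 2) +
        ∑ p ∈ Nat.primesLE ⌊ξ ^ beta 3⌋₊,
          ((shcExponent (Real.log 2 / Real.log ξ) p : ℝ) - 2) * Real.log p ∧
      log2d (shcAt ξ) = (Nat.primeCounting ⌊ξ⌋₊ : ℝ) + beta 2 * Nat.primeCounting ⌊ξ ^ beta 2⌋₊ +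
        (∑ p ∈ Nat.primesLE ⌊ξ ^ beta 3⌋₊,
          (Real.log ((shcExponent (Real.log 2 / Real.log ξ) p : ℝ) + 1) - Real.log 3)) / Real.log 2 := by
  obtain ⟨K, X, hK, hX1, hθ⟩ := theta_control_of_RH hRH
  obtain ⟨hb0, hb34⟩ := beta_two_bounds
  obtain ⟨hb1, hb2⟩ := beta_two_bounds'
  have hb3 := beta_three_lt_half
  have hb30 : 0 < beta 3 := div_pos (Real.log_pos (by norm_num)) (Real.log_pos one_lt_two)
  have hl2 : 0 < Real.log 2 := Real.log_pos one_lt_two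
  -- eventual conditions
  have hev : ∀ᶠ ξ : ℝ in atTop, X ≤ ξ ∧ X ≤ ξ ^ beta 2 ∧ Real.exp 64 ≤ ξ ∧
      4 * K * Real.log ξ ^ 2 ≤ ξ ^ (1 / 10 : ℝ) ∧ (5 : ℝ) ≤ ξ ^ (3 / 5 - beta 2) ∧
      8 / Real.log 2 ^ 2 * Real.log ξ ^ 1 ≤ ξ ^ (3 / 5 - beta 3) ∧
      30 / Real.log 2 * Real.log ξ ^ 4 ≤ ξ ^ (1 / 2 - beta 3) ∧ (40 : ℝ) ≤ ξ ^ (2 / 5 : ℝ) := by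
    refine (eventually_ge_atTop X).and (((tendsto_rpow_atTop hb0).eventually_ge_atTop X).and
      ((eventually_ge_atTop _).and ((eventually_mul_log_pow_le_rpow' _ 2 (by norm_num)).and
      (((tendsto_rpow_atTop (by linarith)).eventually_ge_atTop _).and
      ((eventually_mul_log_pow_le_rpow' _ 1 (by linarith)).and
      ((eventually_mul_log_pow_le_rpow' _ 4 (by linarith)).and
      ((tendsto_rpow_atTop (by norm_num)).eventually_ge_atTop _)))))))
  obtain ⟨X₁, hX₁⟩ := Filter.eventually_atTop.1 hev
  refine ⟨K, max X₁ 2, hK, by linarith [le_max_right X₁ 2], fun ξ hξ ↦ ?_⟩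
  obtain ⟨hξX, hyX, hξe, hs1, hs2, hs3, hs4, hs5⟩ := hX₁ ξ ((le_max_left _ _).trans hξ)
  have hξ2 : 2 ≤ ξ := (le_max_right _ _).trans hξ
  have hξ0 : 0 < ξ := by linarith
  have hl : 64 ≤ Real.log ξ := by rw [Real.le_log_iff_exp_le hξ0]; exact hξe
  have hsξ : 0 < Real.sqrt ξ := Real.sqrt_pos.2 hξ0
  have hy0 : 0 < ξ ^ beta 2 := Real.rpow_pos_of_pos hξ0 _
  obtain ⟨hT1, -⟩ := hθ ξ hξX
  obtain ⟨hU1, hU2⟩ := hθ _ hyX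
  have hUlo : 3 * ξ ^ beta 2 / 4 ≤ θ (ξ ^ beta 2) := by have := (abs_le.1 hU1).1; linarith
  have hUhi : θ (ξ ^ beta 2) ≤ 5 * ξ ^ beta 2 / 4 := by have := (abs_le.1 hU1).2; linarith
  -- (a) θ control ≤ ξ^{3/5}/4
  have ha : K * Real.sqrt ξ * Real.log ξ ^ 2 ≤ ξ ^ (3 / 5 : ℝ) / 4 := by
    have e35 : ξ ^ (3 / 5 : ℝ) = ξ ^ (1 / 10 : ℝ) * Real.sqrt ξ := by
      rw [Real.sqrt_eq_rpow, ← Real.rpow_add hξ0]; norm_num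
    rw [e35]
    have := mul_le_mul_of_nonneg_right hs1 hsξ.le
    linarith
  -- (b) second level ≤ ξ^{3/5}/4
  have hb : 5 * ξ ^ beta 2 / 4 ≤ ξ ^ (3 / 5 : ℝ) / 4 := by
    have e35b : ξ ^ (3 / 5 : ℝ) = ξ ^ (3 / 5 - beta 2) * ξ ^ beta 2 := by
      rw [← Real.rpow_add hξ0]; norm_num
    rw [e35b]
    have := mul_le_mul_of_nonneg_right hs2 hy0.le
    linarith
  -- (e) ξ^{3/5} ≤ ξ/40
  have he : ξ ^ (3 / 5 : ℝ) ≤ ξ / 40 := by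
    have e1 : ξ = ξ ^ (2 / 5 : ℝ) * ξ ^ (3 / 5 : ℝ) := by
      rw [← Real.rpow_add hξ0]; norm_num
    rw [le_div_iff₀ (by norm_num : (0:ℝ) < 40)]
    have := mul_le_mul_of_nonneg_right hs5 (Real.rpow_nonneg hξ0.le (3 / 5 : ℝ))
    linarith [e1]
  rw [pow_one, div_mul_eq_mul_div, div_le_iff₀ (by positivity)] at hs3
  rw [div_mul_eq_mul_div, div_le_iff₀ hl2] at hs4
  exact ⟨hl, hT1, ha, hUlo, hUhi, hb, ⟨(sum_level_three_log_bounds hξ2).1, level_three_log_le hξ2 hs3⟩,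
    ⟨div_nonneg (sum_level_three_log_succ_bounds hξ2).1 hl2.le, level_three_log2d_le hξ2 hs4⟩, he,
    log_shcNumber_two_levels hξ2, log2d_shcNumber_two_levels hξ2⟩

set_option maxHeartbeats 400000 in
/-- **(1.8) at `N(ξ)` with room to spare, under RH**: for all large `ξ`,
`log d(N(ξ))/log 2 ≤ F(L) − R(L) − 6.5 √ξ/log³ ξ` with `L = log N(ξ)` (the printed constant in
(1.8)/(4.2) is `5.12 √L/log³ L`; the tree's Prop. 2.12 band gives `8 − 4τ − 0.01 ≥ 7.8`, of which
`0.5 + 0.2` is spent on `R(ξ) − R(L)` and the levels `k ≥ 3`).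
[cite: Nicolas2022HC, Prop. 4.1 (4.2) (upper bound), §4.1] -/
theorem log2d_shcAt_le_of_RH (hRH : RiemannHypothesis) : ∀ᶠ ξ : ℝ in atTop,
    log2d (shcAt ξ) ≤ F (Real.log (shcAt ξ)) - R (Real.log (shcAt ξ)) -
      6.5 * (Real.sqrt ξ / Real.log ξ ^ 3) := by
  obtain ⟨K, X, hK, hX1, hS⟩ := shcAt_setup_of_RH hRH
  obtain ⟨C, Ξ, hC, hΞ, hRdiff⟩ := abs_R_sub_R_le_of_RH hRH
  obtain ⟨hb0, hb34⟩ := beta_two_bounds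
  obtain ⟨hb1, hb2⟩ := beta_two_bounds'
  have hlam := nicolasBeta_lt'
  filter_upwards [eventually_ge_atTop X, eventually_ge_atTop Ξ,
    prop_2_12_of_RH hRH (by norm_num : (0 : ℝ) < 0.01),
    (tendsto_rpow_atTop hb0).eventually (eventually_liThetaSubPi_pos_of_riemannHypothesis hRH),
    eventually_mul_log_pow_le_rpow' (4 * C) 3 (by norm_num : (0 : ℝ) < 2 / 5)]
    with ξ hξX hξΞ hP hA2 hsm
  obtain ⟨hl, hT1, hTδ, hUlo, hUhi, hUδ, ⟨hE0, hEδ⟩, ⟨hD0, hDW⟩, hδ, hL, hlog2d⟩ := hS ξ hξX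
  have hξ0 : 0 < ξ := by linarith
  have hξ1 : 1 ≤ ξ := by linarith
  have hl0 : 0 < Real.log ξ := by linarith
  have hsξ : 0 < Real.sqrt ξ := Real.sqrt_pos.2 hξ0
  have hy0 : 0 < ξ ^ beta 2 := Real.rpow_pos_of_pos hξ0 _
  have hξ64 : 64 ≤ ξ := by
    have h1 : Real.log ξ ≤ ξ - 1 := Real.log_le_sub_one_of_pos hξ0
    linarith
  have hs8 : 8 ≤ Real.sqrt ξ := by
    rw [show (8 : ℝ) = Real.sqrt (8 ^ 2) by rw [Real.sqrt_sq (by norm_num)]]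
    exact Real.sqrt_le_sqrt (by linarith)
  have hy8 : 8 ≤ ξ ^ beta 2 := by
    calc (8 : ℝ) ≤ Real.sqrt ξ := hs8
      _ = ξ ^ (1 / 2 : ℝ) := Real.sqrt_eq_rpow ξ
      _ ≤ ξ ^ beta 2 := Real.rpow_le_rpow_of_exponent_le hξ1 hb1.le
  have hA1 := liThetaSubPi_def ξ
  have hA2' := liThetaSubPi_def (ξ ^ beta 2)
  set b := beta 2 with hb
  set T := θ ξ with hT
  set U := θ (ξ ^ b) with hU
  set E₃ := ∑ p ∈ Nat.primesLE ⌊ξ ^ beta 3⌋₊,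
    ((shcExponent (Real.log 2 / Real.log ξ) p : ℝ) - 2) * Real.log p with hE₃
  set D := (∑ p ∈ Nat.primesLE ⌊ξ ^ beta 3⌋₊,
    (Real.log ((shcExponent (Real.log 2 / Real.log ξ) p : ℝ) + 1) - Real.log 3)) / Real.log 2 with hD
  set L := Real.log (shcAt ξ) with hLdef
  set W := Real.sqrt ξ / Real.log ξ ^ 3 with hW
  -- ranges
  have hTlo : ξ - ξ ^ (3 / 5 : ℝ) / 4 ≤ T := by have := (abs_le.1 hT1).1; linarith
  have hThi : T ≤ ξ + ξ ^ (3 / 5 : ℝ) / 4 := by have := (abs_le.1 hT1).2; linarith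
  have hU0 : 0 < U := by linarith
  have hLξ : |ξ - L| ≤ ξ ^ (3 / 5 : ℝ) := by
    rw [hL, abs_le]; constructor <;> linarith
  have hL34 : 3 * ξ / 4 ≤ L := by rw [hL]; linarith
  have hL32 : L ≤ 3 * ξ / 2 := by rw [hL]; linarith
  have hT0 : 0 < T := by linarith
  have hL0 : 0 < L := by linarith
  have hTL : T ≤ L := by rw [hL]; linarith
  have hT1' : 1 < T := by linarith
  have hU1' : 1 < U := by linarith
  have hL1' : 1 < L := by linarith
  have hLb1 : 1 < L ^ b := Real.one_lt_rpow hL1' hb0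
  have hlogL0 : 0 < Real.log L := Real.log_pos hL1'
  have hlogLb : Real.log (L ^ b) = b * Real.log L := Real.log_rpow hL0 b
  have hbne : b ≠ 0 := hb0.ne'
  have hlLne : Real.log L ≠ 0 := hlogL0.ne'
  -- the `li` terms are `≥ E₃/log L ≥ 0`
  have h1 : (L - T) / Real.log L ≤ logIntegral L - logIntegral T :=
    sub_div_log_le_logIntegral_sub hT1' hTL
  have h2 : b * (logIntegral U - logIntegral (L ^ b)) ≤ (U - L ^ b) / Real.log L := by
    rcases le_total (L ^ b) U with h | h
    · have hh := logIntegral_sub_le_sub_div_log hLb1 h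
      rw [hlogLb] at hh
      calc b * (logIntegral U - logIntegral (L ^ b)) ≤ b * ((U - L ^ b) / (b * Real.log L)) :=
            mul_le_mul_of_nonneg_left hh hb0.le
        _ = (U - L ^ b) / Real.log L := by field_simp
    · have hh := sub_div_log_le_logIntegral_sub hU1' h
      rw [hlogLb] at hh
      have hh' := mul_le_mul_of_nonneg_left hh hb0.le
      have e : b * ((L ^ b - U) / (b * Real.log L)) = (L ^ b - U) / Real.log L := by field_simp
      rw [e] at hh'
      have e2 : (U - L ^ b) / Real.log L = -((L ^ b - U) / Real.log L) := by ring
      rw [e2]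
      linarith
  have hli : 0 ≤ (logIntegral L - logIntegral T) - b * (logIntegral U - logIntegral (L ^ b)) -
      L ^ b / Real.log L := by
    have e : (L - T) / Real.log L - (U - L ^ b) / Real.log L - L ^ b / Real.log L =
        (L - T - U) / Real.log L := by ring
    have e2 : L - T - U = E₃ := by rw [hL]; ring
    have h3 : 0 ≤ (L - T - U) / Real.log L := by rw [e2]; exact div_nonneg hE0 hlogL0.le
    linarith
  -- `R(ξ) − R(L)`
  have hR : |R ξ - R L| ≤ 0.5 * W := by
    refine (hRdiff ξ L hξΞ hL34 hL32).trans ?_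
    have hx : |ξ - L| / Real.sqrt ξ ≤ ξ ^ (1 / 10 : ℝ) := by
      rw [div_le_iff₀ hsξ]
      calc |ξ - L| ≤ ξ ^ (3 / 5 : ℝ) := hLξ
        _ = ξ ^ (1 / 10 : ℝ) * Real.sqrt ξ := by
            rw [Real.sqrt_eq_rpow, ← Real.rpow_add hξ0]; norm_num
    have hx1 : 1 ≤ ξ ^ (1 / 10 : ℝ) := Real.one_le_rpow hξ1 (by norm_num)
    have e : ξ ^ (2 / 5 : ℝ) * ξ ^ (1 / 10 : ℝ) = Real.sqrt ξ := by
      rw [Real.sqrt_eq_rpow, ← Real.rpow_add hξ0]; norm_num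
    calc C * (|ξ - L| / Real.sqrt ξ + 1) ≤ C * (ξ ^ (1 / 10 : ℝ) + ξ ^ (1 / 10 : ℝ)) := by
          gcongr
      _ = 0.5 * ((4 * C * Real.log ξ ^ 3) * ξ ^ (1 / 10 : ℝ)) / Real.log ξ ^ 3 := by
          rw [eq_div_iff (pow_pos hl0 3).ne']
          ring
      _ ≤ 0.5 * (ξ ^ (2 / 5 : ℝ) * ξ ^ (1 / 10 : ℝ)) / Real.log ξ ^ 3 := by gcongr
      _ = 0.5 * W := by rw [e, hW]; ring
  -- `A(ξ) − R(ξ) ≥ 7.8 W`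
  have hAR : 7.8 * W ≤ liThetaSubPi ξ - R ξ := by
    have h := (abs_le.1 hP).1
    have e : 8 * Real.sqrt ξ / Real.log ξ ^ 3 = 8 * W := by rw [hW]; ring
    rw [e] at h
    have hW0 : 0 ≤ W := by positivity
    have : (4 * nicolasBeta + 0.01) * W ≤ 0.2 * W := mul_le_mul_of_nonneg_right (by linarith) hW0
    linarith
  -- assemble
  have hA2pos : 0 ≤ b * liThetaSubPi (ξ ^ b) := mul_nonneg hb0.le hA2.le
  have hb2' : b * (Nat.primeCounting ⌊ξ ^ b⌋₊ : ℝ) = b * logIntegral U - b * liThetaSubPi (ξ ^ b) := by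
    rw [hA2']; ring
  have hR1 := (abs_le.1 hR).1
  rw [hlog2d, F]
  linarith

/-! ### §3. Interpolation between consecutive `N(m)` -/

/-- `|log u| ≤ 2|u − 1|` for `|u − 1| ≤ 1/2`. [folklore] -/
private theorem abs_log_le_two_mul' {u : ℝ} (hu : |u - 1| ≤ 1 / 2) : |Real.log u| ≤ 2 * |u - 1| := by
  have hu1 := (abs_le.1 hu).1
  have hu2 := (abs_le.1 hu).2
  have hu0 : 0 < u := by linarith
  have h1 : Real.log u ≤ u - 1 := Real.log_le_sub_one_of_pos hu0
  have h2 : 1 - 1 / u ≤ Real.log u := by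
    have := Real.log_le_sub_one_of_pos (inv_pos.2 hu0)
    rw [Real.log_inv] at this
    rw [one_div]; linarith
  have h3 : -(2 * |u - 1|) ≤ 1 - 1 / u := by
    rw [one_div]
    rcases le_or_gt 1 u with h | h
    · rw [abs_of_nonneg (by linarith)]
      have : u⁻¹ ≤ 1 := inv_le_one_of_one_le₀ h
      nlinarith
    · rw [abs_of_neg (by linarith)]
      have hinv : u⁻¹ ≤ 2 := by rw [inv_le_comm₀ hu0 two_pos]; linarith
      have : 1 - u⁻¹ = (u - 1) * u⁻¹ := by field_simp
      rw [this]
      nlinarith [inv_pos.2 hu0]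
  rw [abs_le]
  constructor <;> linarith [le_abs_self (u - 1)]

/-- `F` grows at least like `(t − L)/log t` (case `L ≤ t`): from the lower slopes of `li`.
[cite: Nicolas2022HC, Lemma 4.3 (convexity between consecutive shc numbers)] -/
private theorem F_sub_F_ge {t L : ℝ} (hL1 : 1 < L) (h : L ≤ t) :
    (t - L) / Real.log t ≤ F t - F L := by
  obtain ⟨hb0, _⟩ := beta_two_bounds
  have hL0 : 0 < L := by linarith
  have ht0 : 0 < t := by linarith
  have hlogL0 : 0 < Real.log L := Real.log_pos hL1
  have hlogt0 : 0 < Real.log t := Real.log_pos (by linarith)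
  have hLb1 : 1 < L ^ beta 2 := Real.one_lt_rpow hL1 hb0
  have hlogtb : Real.log (t ^ beta 2) = beta 2 * Real.log t := Real.log_rpow ht0 _
  have hbne : beta 2 ≠ 0 := hb0.ne'
  have hltne : Real.log t ≠ 0 := hlogt0.ne'
  have i1 : (t - L) / Real.log t ≤ logIntegral t - logIntegral L := sub_div_log_le_logIntegral_sub hL1 h
  have hbb : L ^ beta 2 ≤ t ^ beta 2 := Real.rpow_le_rpow hL0.le h hb0.le
  have i2 := sub_div_log_le_logIntegral_sub hLb1 hbb
  rw [hlogtb] at i2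
  have i2' : (t ^ beta 2 - L ^ beta 2) / Real.log t ≤
      beta 2 * (logIntegral (t ^ beta 2) - logIntegral (L ^ beta 2)) := by
    have := mul_le_mul_of_nonneg_left i2 hb0.le
    have e : beta 2 * ((t ^ beta 2 - L ^ beta 2) / (beta 2 * Real.log t)) =
        (t ^ beta 2 - L ^ beta 2) / Real.log t := by field_simp
    linarith [e]
  have i3 : L ^ beta 2 / Real.log t ≤ L ^ beta 2 / Real.log L :=
    div_le_div_of_nonneg_left (by positivity) hlogL0 (Real.log_le_log hL0 h)
  have e : t ^ beta 2 / Real.log t = (t ^ beta 2 - L ^ beta 2) / Real.log t + L ^ beta 2 / Real.log t := by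
    ring
  rw [F, F]
  linarith

/-- `F` grows at most like `(L − t)/log t + L^{β₂}(L − t)/(t log t log L)` (case `t ≤ L`): from the
upper slopes of `li`. [cite: Nicolas2022HC, Lemma 4.3] -/
private theorem F_sub_F_le {t L : ℝ} (ht1 : 1 < t) (h : t ≤ L) :
    F L - F t ≤ (L - t) / Real.log t + (L - t) * (L ^ beta 2 / (t * Real.log t * Real.log L)) := by
  obtain ⟨hb0, _⟩ := beta_two_bounds
  have ht0 : 0 < t := by linarith
  have hL0 : 0 < L := by linarith
  have hL1 : 1 < L := by linarith
  have hlogt0 : 0 < Real.log t := Real.log_pos ht1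
  have hlogL0 : 0 < Real.log L := Real.log_pos hL1
  have htb1 : 1 < t ^ beta 2 := Real.one_lt_rpow ht1 hb0
  have hlogtb : Real.log (t ^ beta 2) = beta 2 * Real.log t := Real.log_rpow ht0 _
  have hbne : beta 2 ≠ 0 := hb0.ne'
  have hltne : Real.log t ≠ 0 := hlogt0.ne'
  have hlLne : Real.log L ≠ 0 := hlogL0.ne'
  have htne : t ≠ 0 := ht0.ne'
  have i1 : logIntegral L - logIntegral t ≤ (L - t) / Real.log t := logIntegral_sub_le_sub_div_log ht1 h
  have hbb : t ^ beta 2 ≤ L ^ beta 2 := Real.rpow_le_rpow ht0.le h hb0.le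
  have i2 := logIntegral_sub_le_sub_div_log htb1 hbb
  rw [hlogtb] at i2
  have i2' : beta 2 * (logIntegral (L ^ beta 2) - logIntegral (t ^ beta 2)) ≤
      (L ^ beta 2 - t ^ beta 2) / Real.log t := by
    have := mul_le_mul_of_nonneg_left i2 hb0.le
    have e : beta 2 * ((L ^ beta 2 - t ^ beta 2) / (beta 2 * Real.log t)) =
        (L ^ beta 2 - t ^ beta 2) / Real.log t := by field_simp
    linarith [e]
  have hlogLt : Real.log L - Real.log t ≤ (L - t) / t := by
    have hh := Real.log_le_sub_one_of_pos (div_pos hL0 ht0)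
    rw [Real.log_div hL0.ne' ht0.ne'] at hh
    have e : L / t - 1 = (L - t) / t := by field_simp
    linarith [e]
  have i3 : L ^ beta 2 / Real.log t - L ^ beta 2 / Real.log L ≤
      (L - t) * (L ^ beta 2 / (t * Real.log t * Real.log L)) := by
    have e : L ^ beta 2 / Real.log t - L ^ beta 2 / Real.log L =
        L ^ beta 2 * (Real.log L - Real.log t) / (Real.log t * Real.log L) := by
      field_simp
    rw [e, div_le_iff₀ (mul_pos hlogt0 hlogL0)]
    calc L ^ beta 2 * (Real.log L - Real.log t) ≤ L ^ beta 2 * ((L - t) / t) :=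
          mul_le_mul_of_nonneg_left hlogLt (by positivity)
      _ = (L - t) * (L ^ beta 2 / (t * Real.log t * Real.log L)) * (Real.log t * Real.log L) := by
          field_simp
  have e : (L ^ beta 2 - t ^ beta 2) / Real.log t + t ^ beta 2 / Real.log t = L ^ beta 2 / Real.log t := by
    ring
  rw [F, F]
  linarith

set_option maxHeartbeats 400000 in
/-- **Variation of `F` against the correction `(t − L)/log ξ`.** For `ξ ≥ e⁴`, `|L − ξ| ≤ δ`,
`|t − L| ≤ Δ`, `δ + Δ ≤ ξ/4`:
`F(L) − F(t) + (t − L)/log ξ ≤ 4Δ(δ + Δ)/(ξ log² ξ) + 8Δ L^{β₂}/(ξ log² ξ)`.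
[cite: Nicolas2022HC, Lemma 4.3, §4.3 (interpolation between consecutive shc numbers)] -/
theorem F_sub_F_add_le {ξ t L δ Δ : ℝ} (hξ : Real.exp 4 ≤ ξ) (hδ : |L - ξ| ≤ δ)
    (hΔ : |t - L| ≤ Δ) (hsmall : δ + Δ ≤ ξ / 4) :
    F L - F t + (t - L) / Real.log ξ ≤
      4 * Δ * (δ + Δ) / (ξ * Real.log ξ ^ 2) + 8 * Δ * L ^ beta 2 / (ξ * Real.log ξ ^ 2) := by
  obtain ⟨hb0, _⟩ := beta_two_bounds
  have hξ0 : 0 < ξ := (Real.exp_pos 4).trans_le hξ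
  have hl4 : 4 ≤ Real.log ξ := by rw [Real.le_log_iff_exp_le hξ0]; exact hξ
  have hl0 : 0 < Real.log ξ := by linarith
  have he4 : (5 : ℝ) ≤ Real.exp 4 := by linarith [Real.add_one_le_exp (4 : ℝ)]
  have hδ0 : 0 ≤ δ := (abs_nonneg _).trans hδ
  have hΔ0 : 0 ≤ Δ := (abs_nonneg _).trans hΔ
  have htξ : |t - ξ| ≤ δ + Δ := by
    have := abs_sub_le t L ξ
    linarith
  have ht34 : 3 * ξ / 4 ≤ t := by have := (abs_le.1 htξ).1; linarith
  have ht54 : t ≤ 5 * ξ / 4 := by have := (abs_le.1 htξ).2; linarith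
  have hL34 : 3 * ξ / 4 ≤ L := by have := (abs_le.1 hδ).1; linarith
  have ht0 : 0 < t := by linarith
  have hL0 : 0 < L := by linarith
  have ht1 : 1 < t := by linarith
  have hL1 : 1 < L := by linarith
  have h34 : -(1 / 3) ≤ Real.log (3 / 4 : ℝ) := by
    have := Real.log_le_sub_one_of_pos (show (0 : ℝ) < 4 / 3 by norm_num)
    rw [show (3 / 4 : ℝ) = (4 / 3)⁻¹ by norm_num, Real.log_inv]
    linarith
  have hlt : Real.log ξ / 2 ≤ Real.log t := by
    have h1 : Real.log (ξ * (3 / 4)) ≤ Real.log t := Real.log_le_log (by positivity) (by linarith)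
    rw [Real.log_mul hξ0.ne' (by norm_num)] at h1
    linarith
  have hlL : Real.log ξ / 2 ≤ Real.log L := by
    have h1 : Real.log (ξ * (3 / 4)) ≤ Real.log L := Real.log_le_log (by positivity) (by linarith)
    rw [Real.log_mul hξ0.ne' (by norm_num)] at h1
    linarith
  have hlogt0 : 0 < Real.log t := by linarith
  have hlogL0 : 0 < Real.log L := by linarith
  -- `|log t − log ξ| ≤ 2(δ + Δ)/ξ`
  have hq : |t / ξ - 1| = |t - ξ| / ξ := by
    rw [show t / ξ - 1 = (t - ξ) / ξ by field_simp, abs_div, abs_of_pos hξ0]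
  have hq' : |t / ξ - 1| ≤ 1 / 2 := by
    rw [hq, div_le_iff₀ hξ0]; linarith
  have hlogdiff : |Real.log t - Real.log ξ| ≤ 2 * (δ + Δ) / ξ := by
    have := abs_log_le_two_mul' hq'
    rw [Real.log_div ht0.ne' hξ0.ne', hq] at this
    calc |Real.log t - Real.log ξ| ≤ 2 * (|t - ξ| / ξ) := this
      _ ≤ 2 * ((δ + Δ) / ξ) := by gcongr
      _ = 2 * (δ + Δ) / ξ := by ring
  -- one-sided bounds for `F`
  have hX0 : 0 ≤ L ^ beta 2 / (t * Real.log t * Real.log L) := by positivity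
  have hmain : F L - F t + (t - L) / Real.log ξ ≤
      |t - L| * |1 / Real.log ξ - 1 / Real.log t| +
        |t - L| * (L ^ beta 2 / (t * Real.log t * Real.log L)) := by
    have hprod : (t - L) * (1 / Real.log ξ - 1 / Real.log t) ≤
        |t - L| * |1 / Real.log ξ - 1 / Real.log t| := by
      rw [← abs_mul]; exact le_abs_self _
    have e2 : (t - L) * (1 / Real.log ξ - 1 / Real.log t) =
        (t - L) / Real.log ξ - (t - L) / Real.log t := by ring
    have hnn : 0 ≤ |t - L| * (L ^ beta 2 / (t * Real.log t * Real.log L)) := by positivity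
    rcases le_total L t with h | h
    · have hF := F_sub_F_ge hL1 h
      linarith
    · have hF := F_sub_F_le ht1 h
      have hprod2 : (L - t) * (L ^ beta 2 / (t * Real.log t * Real.log L)) ≤
          |t - L| * (L ^ beta 2 / (t * Real.log t * Real.log L)) := by
        refine mul_le_mul_of_nonneg_right ?_ hX0
        rw [abs_sub_comm]; exact le_abs_self _
      have e3 : (L - t) / Real.log t = -((t - L) / Real.log t) := by ring
      linarith
  -- the two factors
  have hf1 : |1 / Real.log ξ - 1 / Real.log t| ≤ 4 * (δ + Δ) / (ξ * Real.log ξ ^ 2) := by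
    rw [div_sub_div _ _ hl0.ne' hlogt0.ne', one_mul, mul_one, abs_div,
      abs_of_pos (mul_pos hl0 hlogt0), abs_sub_comm]
    calc |Real.log ξ - Real.log t| / (Real.log ξ * Real.log t)
        = |Real.log t - Real.log ξ| / (Real.log ξ * Real.log t) := by rw [abs_sub_comm]
      _ ≤ (2 * (δ + Δ) / ξ) / (Real.log ξ * (Real.log ξ / 2)) :=
          div_le_div₀ (by positivity) hlogdiff (by positivity)
            (mul_le_mul_of_nonneg_left hlt hl0.le)
      _ = 4 * (δ + Δ) / (ξ * Real.log ξ ^ 2) := by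
          field_simp
          ring
  have hf2 : L ^ beta 2 / (t * Real.log t * Real.log L) ≤ 8 * L ^ beta 2 / (ξ * Real.log ξ ^ 2) := by
    have hden : ξ * Real.log ξ ^ 2 / 8 ≤ t * Real.log t * Real.log L := by
      calc ξ * Real.log ξ ^ 2 / 8 ≤ 3 * ξ / 4 * (Real.log ξ / 2) * (Real.log ξ / 2) := by
            nlinarith [sq_nonneg (Real.log ξ)]
        _ ≤ t * Real.log t * Real.log L := by gcongr
    calc L ^ beta 2 / (t * Real.log t * Real.log L) ≤ L ^ beta 2 / (ξ * Real.log ξ ^ 2 / 8) :=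
          div_le_div_of_nonneg_left (by positivity) (by positivity) hden
      _ = 8 * L ^ beta 2 / (ξ * Real.log ξ ^ 2) := by
          field_simp
  calc F L - F t + (t - L) / Real.log ξ
      ≤ |t - L| * |1 / Real.log ξ - 1 / Real.log t| +
          |t - L| * (L ^ beta 2 / (t * Real.log t * Real.log L)) := hmain
    _ ≤ Δ * (4 * (δ + Δ) / (ξ * Real.log ξ ^ 2)) + Δ * (8 * L ^ beta 2 / (ξ * Real.log ξ ^ 2)) := by
        gcongr
    _ = 4 * Δ * (δ + Δ) / (ξ * Real.log ξ ^ 2) + 8 * Δ * L ^ beta 2 / (ξ * Real.log ξ ^ 2) := by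
        ring

/-- The printed error term varies little: `5.12 √t/log³ t ≤ 5.9 √ξ/log³ ξ` for `|t − ξ| ≤ ξ/8`,
`ξ ≥ e⁶⁴`. [folklore] -/
private theorem scale_le {ξ t : ℝ} (hξ : Real.exp 64 ≤ ξ) (ht : |t - ξ| ≤ ξ / 8) :
    5.12 * Real.sqrt t / Real.log t ^ 3 ≤ 5.9 * (Real.sqrt ξ / Real.log ξ ^ 3) := by
  have hξ0 : 0 < ξ := (Real.exp_pos 64).trans_le hξ
  have hl : 64 ≤ Real.log ξ := by rw [Real.le_log_iff_exp_le hξ0]; exact hξ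
  have hl0 : 0 < Real.log ξ := by linarith
  have he : (5 : ℝ) ≤ Real.exp 64 := by linarith [Real.add_one_le_exp (64 : ℝ)]
  have ht1 : 7 * ξ / 8 ≤ t := by have := (abs_le.1 ht).1; linarith
  have ht2 : t ≤ 9 * ξ / 8 := by have := (abs_le.1 ht).2; linarith
  have ht0 : 0 < t := by linarith
  have hst : Real.sqrt t ≤ 1.061 * Real.sqrt ξ := by
    have e : 1.061 * Real.sqrt ξ = Real.sqrt ((1.061 : ℝ) ^ 2 * ξ) := by
      rw [Real.sqrt_mul' _ hξ0.le, Real.sqrt_sq (by norm_num)]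
    rw [e]
    exact Real.sqrt_le_sqrt (by nlinarith)
  have h78 : -(1 / 7) ≤ Real.log (7 / 8 : ℝ) := by
    have := Real.log_le_sub_one_of_pos (show (0 : ℝ) < 8 / 7 by norm_num)
    rw [show (7 / 8 : ℝ) = (8 / 7)⁻¹ by norm_num, Real.log_inv]
    linarith
  have hlt : Real.log ξ - 1 / 7 ≤ Real.log t := by
    have h1 : Real.log (ξ * (7 / 8)) ≤ Real.log t := Real.log_le_log (by positivity) (by linarith)
    rw [Real.log_mul hξ0.ne' (by norm_num)] at h1
    linarith
  have hlt0 : 0 < Real.log t := by linarith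
  have hl3 : Real.log ξ ≤ 1.0023 * Real.log t := by linarith
  have hcube : Real.log ξ ^ 3 ≤ (1.0023 * Real.log t) ^ 3 := pow_le_pow_left₀ hl0.le hl3 3
  rw [div_le_iff₀ (pow_pos hlt0 3)]
  have key : Real.sqrt ξ * Real.log ξ ^ 3 ≤ Real.sqrt ξ * ((1.0023 : ℝ) ^ 3 * Real.log t ^ 3) := by
    rw [← mul_pow]; exact mul_le_mul_of_nonneg_left hcube (Real.sqrt_nonneg ξ)
  have e : 5.9 * (Real.sqrt ξ / Real.log ξ ^ 3) * Real.log t ^ 3 =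
      5.9 * (Real.sqrt ξ * Real.log t ^ 3) / Real.log ξ ^ 3 := by ring
  rw [e, le_div_iff₀ (pow_pos hl0 3)]
  nlinarith [Real.sqrt_nonneg ξ, Real.sqrt_nonneg t, pow_pos hlt0 3, pow_pos hl0 3,
    mul_le_mul_of_nonneg_right hst (pow_nonneg hl0.le 3)]

/-- Choosing the shc number below a target: for a function with `m/2 ≤ L(m) ≤ 2m` (`m ≥ X₁`) and
`t ≥ 2X₁ + 2`, some `m ≥ max(X₁, t/2 − 1)` has `L(m) ≤ t < L(m+1)`. [folklore] -/
private theorem exists_between (Lf : ℕ → ℝ) (X₁ : ℕ)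
    (h : ∀ m : ℕ, X₁ ≤ m → (m : ℝ) / 2 ≤ Lf m ∧ Lf m ≤ 2 * m) {t : ℝ} (ht : 2 * (X₁ : ℝ) + 2 ≤ t) :
    ∃ m : ℕ, X₁ ≤ m ∧ t / 2 - 1 ≤ m ∧ Lf m ≤ t ∧ t < Lf (m + 1) := by
  classical
  have hX0 : (0 : ℝ) ≤ X₁ := Nat.cast_nonneg _
  set B := ⌊2 * t⌋₊ + 1 with hB
  have hBt : t < (B : ℝ) / 2 := by
    rw [hB]; push_cast
    have := Nat.lt_floor_add_one (2 * t)
    linarith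
  have hXB : X₁ ≤ B := by exact_mod_cast (show (X₁ : ℝ) ≤ B by linarith)
  have hPB : ¬ Lf B ≤ t := by
    intro hP
    have := (h B hXB).1
    linarith
  set m₁ := ⌊t / 2⌋₊ with hm₁
  have hm₁t : (m₁ : ℝ) ≤ t / 2 := Nat.floor_le (by linarith)
  have hm₁t' : t / 2 - 1 ≤ m₁ := by
    have := Nat.lt_floor_add_one (t / 2)
    rw [hm₁]; linarith
  have hX₁m₁ : X₁ ≤ m₁ := by exact_mod_cast (show (X₁ : ℝ) ≤ m₁ by linarith)
  have hm₁B : m₁ ≤ B := by exact_mod_cast (show (m₁ : ℝ) ≤ B by linarith)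
  have hPm₁ : Lf m₁ ≤ t := by have := (h m₁ hX₁m₁).2; linarith
  have hspec : Lf (Nat.findGreatest (fun m ↦ Lf m ≤ t) B) ≤ t :=
    Nat.findGreatest_spec (P := fun m ↦ Lf m ≤ t) hm₁B hPm₁
  have hle : m₁ ≤ Nat.findGreatest (fun m ↦ Lf m ≤ t) B :=
    Nat.le_findGreatest (P := fun m ↦ Lf m ≤ t) hm₁B hPm₁
  refine ⟨Nat.findGreatest (fun m ↦ Lf m ≤ t) B, hX₁m₁.trans hle,
    hm₁t'.trans (by exact_mod_cast hle), hspec, ?_⟩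
  have hlt : Nat.findGreatest (fun m ↦ Lf m ≤ t) B < B := by
    refine lt_of_le_of_ne (Nat.findGreatest_le B) (fun hEq ↦ hPB ?_)
    rw [← hEq]; exact hspec
  exact not_le.1 (Nat.findGreatest_is_greatest (Nat.lt_succ_self _) (Nat.succ_le_of_lt hlt))

/-- The `F`-correction over a gap `|t − L| ≤ 4ξ^{3/5}` with `|L − ξ| ≤ ξ^{3/5}` is
`≤ 0.3 √ξ/log³ ξ` once `log ξ ≥ 64`, `ξ^{3/5} ≤ ξ/40` and `500 log ξ ≤ ξ^{3/10}`. [folklore] -/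
private theorem interp_F_small {ξ t L : ℝ} (hξ0 : 0 < ξ) (hl : 64 ≤ Real.log ξ)
    (hδ' : |L - ξ| ≤ ξ ^ (3 / 5 : ℝ)) (hΔ : |t - L| ≤ 4 * ξ ^ (3 / 5 : ℝ))
    (hδ : ξ ^ (3 / 5 : ℝ) ≤ ξ / 40) (hs1 : 500 * Real.log ξ ≤ ξ ^ (3 / 10 : ℝ)) :
    F L - F t + (t - L) / Real.log ξ ≤ 0.3 * (Real.sqrt ξ / Real.log ξ ^ 3) := by
  obtain ⟨hb0, hb34⟩ := beta_two_bounds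
  obtain ⟨hb1, hb2⟩ := beta_two_bounds'
  have hl0 : 0 < Real.log ξ := by linarith
  have hξ1 : 1 < ξ := by
    by_contra h
    linarith [Real.log_nonpos hξ0.le (not_lt.1 h)]
  have hξe4 : Real.exp 4 ≤ ξ :=
    (Real.exp_le_exp.2 (by norm_num)).trans ((Real.le_log_iff_exp_le hξ0).1 hl)
  have hz : 0 ≤ ξ ^ (3 / 5 : ℝ) := Real.rpow_nonneg hξ0.le _
  have hsmall : ξ ^ (3 / 5 : ℝ) + 4 * ξ ^ (3 / 5 : ℝ) ≤ ξ / 4 := by linarith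
  have hL0 : 0 < L := by have := (abs_le.1 hδ').1; linarith
  have hLhi : L ≤ ξ * (3 / 2) := by have := (abs_le.1 hδ').2; linarith
  refine (F_sub_F_add_le hξe4 hδ' hΔ hsmall).trans ?_
  have h32 : (3 / 2 : ℝ) ^ beta 2 ≤ 3 / 2 := by
    calc (3 / 2 : ℝ) ^ beta 2 ≤ (3 / 2 : ℝ) ^ (1 : ℝ) :=
          Real.rpow_le_rpow_of_exponent_le (by norm_num) (by linarith)
      _ = 3 / 2 := Real.rpow_one _
  have hLb : L ^ beta 2 ≤ 3 / 2 * ξ ^ (3 / 5 : ℝ) := by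
    calc L ^ beta 2 ≤ (ξ * (3 / 2)) ^ beta 2 := Real.rpow_le_rpow hL0.le hLhi hb0.le
      _ = ξ ^ beta 2 * (3 / 2 : ℝ) ^ beta 2 := Real.mul_rpow hξ0.le (by norm_num)
      _ ≤ ξ ^ (3 / 5 : ℝ) * (3 / 2 : ℝ) :=
          mul_le_mul (Real.rpow_le_rpow_of_exponent_le hξ1.le hb2.le) h32 (by positivity) hz
      _ = 3 / 2 * ξ ^ (3 / 5 : ℝ) := by ring
  have e65 : ξ ^ (3 / 5 : ℝ) * ξ ^ (3 / 5 : ℝ) = ξ ^ (1 / 5 : ℝ) * ξ := by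
    rw [← Real.rpow_add hξ0, ← Real.rpow_add_one hξ0.ne']; norm_num
  have e12 : ξ ^ (1 / 5 : ℝ) * ξ ^ (3 / 10 : ℝ) = Real.sqrt ξ := by
    rw [Real.sqrt_eq_rpow, ← Real.rpow_add hξ0]; norm_num
  have hnum : 4 * (4 * ξ ^ (3 / 5 : ℝ)) * (ξ ^ (3 / 5 : ℝ) + 4 * ξ ^ (3 / 5 : ℝ)) +
      8 * (4 * ξ ^ (3 / 5 : ℝ)) * L ^ beta 2 ≤ 128 * (ξ ^ (1 / 5 : ℝ) * ξ) := by
    have := mul_le_mul_of_nonneg_left hLb (by positivity : (0 : ℝ) ≤ 32 * ξ ^ (3 / 5 : ℝ))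
    linarith [e65]
  rw [← add_div, div_le_iff₀ (by positivity)]
  refine hnum.trans ?_
  have key : 128 * ξ ^ (1 / 5 : ℝ) * Real.log ξ ≤ 0.3 * Real.sqrt ξ := by
    rw [← e12]
    have := mul_le_mul_of_nonneg_left hs1 (Real.rpow_nonneg hξ0.le (1 / 5 : ℝ))
    have hp : 0 ≤ ξ ^ (1 / 5 : ℝ) * ξ ^ (3 / 10 : ℝ) := by positivity
    linarith
  have e : 0.3 * (Real.sqrt ξ / Real.log ξ ^ 3) * (ξ * Real.log ξ ^ 2) =
      (0.3 * Real.sqrt ξ) * ξ / Real.log ξ := by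
    field_simp
  rw [e, le_div_iff₀ hl0]
  have := mul_le_mul_of_nonneg_right key hξ0.le
  linarith

/-- The `R`-correction over the same gap is `≤ 0.3 √ξ/log³ ξ` once `(80C/3) log³ ξ ≤ ξ^{2/5}`
(`R` slowly varying with constant `C`). [folklore] -/
private theorem interp_R_small {ξ t L C : ℝ} (hξ1 : 1 < ξ) (hC : 0 < C)
    (r1 : |R ξ - R t| ≤ C * (|ξ - t| / Real.sqrt ξ + 1))
    (r2 : |R ξ - R L| ≤ C * (|ξ - L| / Real.sqrt ξ + 1))
    (hδ' : |L - ξ| ≤ ξ ^ (3 / 5 : ℝ)) (hΔ : |t - L| ≤ 4 * ξ ^ (3 / 5 : ℝ))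
    (hs2 : 80 * C / 3 * Real.log ξ ^ 3 ≤ ξ ^ (2 / 5 : ℝ)) :
    R t - R L ≤ 0.3 * (Real.sqrt ξ / Real.log ξ ^ 3) := by
  have hξ0 : 0 < ξ := by linarith
  have hl0 : 0 < Real.log ξ := Real.log_pos hξ1
  have hsξ : 0 < Real.sqrt ξ := Real.sqrt_pos.2 hξ0
  have hx1 : 1 ≤ ξ ^ (1 / 10 : ℝ) := Real.one_le_rpow hξ1.le (by norm_num)
  have e35 : ξ ^ (3 / 5 : ℝ) = ξ ^ (1 / 10 : ℝ) * Real.sqrt ξ := by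
    rw [Real.sqrt_eq_rpow, ← Real.rpow_add hξ0]; norm_num
  have hx : |ξ - t| / Real.sqrt ξ ≤ 5 * ξ ^ (1 / 10 : ℝ) := by
    rw [div_le_iff₀ hsξ, abs_sub_comm]
    have := abs_sub_le t L ξ
    linarith [e35]
  have hx' : |ξ - L| / Real.sqrt ξ ≤ ξ ^ (1 / 10 : ℝ) := by
    rw [div_le_iff₀ hsξ, abs_sub_comm, ← e35]; exact hδ'
  have e : ξ ^ (2 / 5 : ℝ) * ξ ^ (1 / 10 : ℝ) = Real.sqrt ξ := by
    rw [Real.sqrt_eq_rpow, ← Real.rpow_add hξ0]; norm_num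
  have hsum : |R ξ - R t| + |R ξ - R L| ≤ 8 * C * ξ ^ (1 / 10 : ℝ) := by
    have i1 : |R ξ - R t| ≤ C * (5 * ξ ^ (1 / 10 : ℝ) + 1) :=
      r1.trans (mul_le_mul_of_nonneg_left (by linarith) hC.le)
    have i2 : |R ξ - R L| ≤ C * (ξ ^ (1 / 10 : ℝ) + 1) :=
      r2.trans (mul_le_mul_of_nonneg_left (by linarith) hC.le)
    have i3 := mul_le_mul_of_nonneg_left hx1 hC.le
    linarith
  have key : 8 * C * ξ ^ (1 / 10 : ℝ) ≤ 0.3 * (Real.sqrt ξ / Real.log ξ ^ 3) := by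
    rw [mul_div_assoc', le_div_iff₀ (pow_pos hl0 3), ← e]
    have := mul_le_mul_of_nonneg_right hs2 (Real.rpow_nonneg hξ0.le (1 / 10 : ℝ))
    linarith
  have a2 := le_abs_self (R ξ - R L)
  have a3 := neg_abs_le (R ξ - R t)
  linarith

set_option maxHeartbeats 400000 in
/-- **Nicolas 2022, Thm. 1.1 (i), asymptotic form: under RH, (1.8) holds for all large `n`.**
`RiemannHypothesis → ∀ᶠ n, log d(n)/log 2 ≤ F(log n) − R(log n) − 5.12 √(log n)/log³ log n
 + 1.52 log^{β₃} n/log log n`. (The tree fact `Nicolas2022_thm_1_1_i` is the explicit version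
`n > 183783600`, which adds a finite computation.) [cite: Nicolas2022HC, Thm. 1.1 (i), Prop. 4.1 (4.2), §4.3] -/
theorem ineq18_eventually_of_RH (hRH : RiemannHypothesis) : ∀ᶠ n : ℕ in atTop, Ineq18 n := by
  classical
  obtain ⟨K, X, hK, hX1, hS⟩ := shcAt_setup_of_RH hRH
  obtain ⟨C, Ξ, hC, hΞ, hRdiff⟩ := abs_R_sub_R_le_of_RH hRH
  have hev : ∀ᶠ ξ : ℝ in atTop, X ≤ ξ ∧ Ξ ≤ ξ ∧
      log2d (shcAt ξ) ≤ F (Real.log (shcAt ξ)) - R (Real.log (shcAt ξ)) -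
        6.5 * (Real.sqrt ξ / Real.log ξ ^ 3) ∧
      500 * Real.log ξ ^ 1 ≤ ξ ^ (3 / 10 : ℝ) ∧ 80 * C / 3 * Real.log ξ ^ 3 ≤ ξ ^ (2 / 5 : ℝ) :=
    (eventually_ge_atTop X).and ((eventually_ge_atTop Ξ).and ((log2d_shcAt_le_of_RH hRH).and
      ((eventually_mul_log_pow_le_rpow' _ 1 (by norm_num)).and
        (eventually_mul_log_pow_le_rpow' _ 3 (by norm_num)))))
  obtain ⟨X₂, hX₂⟩ := Filter.eventually_atTop.1 hev
  set X₁ : ℕ := ⌈max X₂ 1⌉₊ with hX₁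
  have hX₁X₂ : X₂ ≤ (X₁ : ℝ) := (le_max_left _ _).trans (Nat.le_ceil _)
  -- two-sided size of `L(m) = log N(m)` for `m ≥ X₁`
  have hsize : ∀ m : ℕ, X₁ ≤ m → |Real.log (shcAt m) - m| ≤ (m : ℝ) ^ (3 / 5 : ℝ) ∧
      (m : ℝ) ^ (3 / 5 : ℝ) ≤ m / 40 := by
    intro m hm
    have hmX : X ≤ (m : ℝ) := (hX₂ _ (hX₁X₂.trans (by exact_mod_cast hm))).1
    obtain ⟨-, hT1, hTδ, hUlo, hUhi, hUδ, ⟨hE0, hEδ⟩, -, hδ, hL, -⟩ := hS m hmX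
    refine ⟨?_, hδ⟩
    have h1 := (abs_le.1 hT1).1
    have h2 := (abs_le.1 hT1).2
    have : 0 ≤ (m : ℝ) ^ beta 2 := Real.rpow_nonneg (Nat.cast_nonneg _) _
    rw [hL, abs_le]; constructor <;> linarith
  have hLf : ∀ m : ℕ, X₁ ≤ m → (m : ℝ) / 2 ≤ Real.log (shcAt m) ∧ Real.log (shcAt m) ≤ 2 * m := by
    intro m hm
    obtain ⟨h1, h2⟩ := hsize m hm
    have h3 := (abs_le.1 h1).1
    have h4 := (abs_le.1 h1).2
    constructor <;> linarith
  -- large `n`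
  have hlog : Tendsto (fun n : ℕ ↦ Real.log n) atTop atTop :=
    Real.tendsto_log_atTop.comp tendsto_natCast_atTop_atTop
  filter_upwards [hlog.eventually_ge_atTop (2 * (X₁ : ℝ) + 2), eventually_ge_atTop 2] with n hn hn2
  obtain ⟨m, hmX₁, hmt, hLm, hLm1⟩ := exists_between (fun m ↦ Real.log (shcAt m)) X₁ hLf hn
  -- facts at `ξ = m`
  have hmX₂ : X₂ ≤ (m : ℝ) := hX₁X₂.trans (by exact_mod_cast hmX₁)
  obtain ⟨hmX, hmΞ, hP1, hs1, hs2⟩ := hX₂ _ hmX₂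
  obtain ⟨hl, -, -, -, -, -, -, -, hδ, -, -⟩ := hS m hmX
  obtain ⟨hLabs, -⟩ := hsize m hmX₁
  obtain ⟨hLabs1, -⟩ := hsize (m + 1) (Nat.le_succ_of_le hmX₁)
  have hξ0 : 0 < (m : ℝ) := by linarith
  have hξ1 : 1 < (m : ℝ) := by linarith
  have hl0 : 0 < Real.log (m : ℝ) := by linarith
  have hξe64 : Real.exp 64 ≤ (m : ℝ) := (Real.le_log_iff_exp_le hξ0).1 hl
  have hz1 : 1 ≤ (m : ℝ) ^ (3 / 5 : ℝ) := Real.one_le_rpow hξ1.le (by norm_num)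
  -- the gap to the next shc number
  have hm1 : ((m + 1 : ℕ) : ℝ) = (m : ℝ) + 1 := by push_cast; ring
  have hpow1 : ((m + 1 : ℕ) : ℝ) ^ (3 / 5 : ℝ) ≤ 2 * (m : ℝ) ^ (3 / 5 : ℝ) := by
    rw [hm1]
    have h22 : (2 : ℝ) ^ (3 / 5 : ℝ) ≤ 2 := by
      calc (2 : ℝ) ^ (3 / 5 : ℝ) ≤ (2 : ℝ) ^ (1 : ℝ) :=
            Real.rpow_le_rpow_of_exponent_le (by norm_num) (by norm_num)
        _ = 2 := Real.rpow_one 2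
    calc ((m : ℝ) + 1) ^ (3 / 5 : ℝ) ≤ (2 * (m : ℝ)) ^ (3 / 5 : ℝ) :=
          Real.rpow_le_rpow (by linarith) (by linarith) (by norm_num)
      _ = (2 : ℝ) ^ (3 / 5 : ℝ) * (m : ℝ) ^ (3 / 5 : ℝ) := Real.mul_rpow (by norm_num) hξ0.le
      _ ≤ 2 * (m : ℝ) ^ (3 / 5 : ℝ) := mul_le_mul_of_nonneg_right h22 (by positivity)
  have hΔ : |Real.log n - Real.log (shcAt m)| ≤ 4 * (m : ℝ) ^ (3 / 5 : ℝ) := by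
    have h1 := (abs_le.1 hLabs1).2
    have h2 := (abs_le.1 hLabs).1
    rw [abs_le]; constructor <;> linarith
  have htξ : |Real.log n - (m : ℝ)| ≤ (m : ℝ) / 8 := by
    have := abs_sub_le (Real.log n) (Real.log (shcAt m)) (m : ℝ)
    linarith
  have htlo : 3 * (m : ℝ) / 4 ≤ Real.log n := by have := (abs_le.1 htξ).1; linarith
  have hthi : Real.log n ≤ 3 * (m : ℝ) / 2 := by have := (abs_le.1 htξ).2; linarith
  have hLlo : 3 * (m : ℝ) / 4 ≤ Real.log (shcAt m) := by have := (abs_le.1 hLabs).1; linarith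
  have hLhi : Real.log (shcAt m) ≤ 3 * (m : ℝ) / 2 := by have := (abs_le.1 hLabs).2; linarith
  have ht1 : 1 < Real.log n := by linarith
  -- (0) maximality, RH-free
  have h0 : log2d n ≤ log2d (shcAt m) + (Real.log n - Real.log (shcAt m)) / Real.log m :=
    log2d_le_shcAt (by omega) hξ1
  -- (3), (4) the `F` and `R` corrections; (5) the printed error term
  rw [pow_one] at hs1
  have h3 := interp_F_small hξ0 hl hLabs hΔ hδ hs1
  have h4 := interp_R_small hξ1 hC (hRdiff _ _ hmΞ htlo hthi) (hRdiff _ _ hmΞ hLlo hLhi) hLabs hΔ hs2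
  have h5 := scale_le hξe64 htξ
  have h6 : 0 ≤ 1.52 * Real.log n ^ beta 3 / Real.log (Real.log n) := by
    have : 0 ≤ Real.log n ^ beta 3 := Real.rpow_nonneg (by linarith) _
    have : 0 < Real.log (Real.log n) := Real.log_pos ht1
    positivity
  -- conclude
  rw [Ineq18]
  linarith [h0, hP1, h3, h4, h5, h6]

/-! ### §4. Corollary 1.2 in asymptotic form (under RH) -/

/-- `log n → ∞` along `n : ℕ`. [folklore] -/
private theorem tendsto_log_natCast : Tendsto (fun n : ℕ ↦ Real.log n) atTop atTop :=
  Real.tendsto_log_atTop.comp tendsto_natCast_atTop_atTop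

/-- **Cor. 1.2 (1.10), asymptotic form**: under RH, for all large `n`,
`log d(n)/log 2 ≤ F(log n) − (2 − τ)√(log n)/log² log n − 5.12 √(log n)/log³ log n
 + 1.52 log^{β₃} n/log log n` (from (1.8) and `R(t) ≥ (2 − τ)√t/log² t`, (1.6)).
[cite: Nicolas2022HC, Cor. 1.2 (1.10)] -/
theorem ineq110_eventually_of_RH (hRH : RiemannHypothesis) : ∀ᶠ n : ℕ in atTop, Ineq110 n := by
  filter_upwards [ineq18_eventually_of_RH hRH, tendsto_log_natCast.eventually_ge_atTop 1]
    with n h18 ht1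
  have hR := le_R_of_RH hRH (by linarith : 0 < Real.log (n : ℝ))
  rw [Ineq18] at h18
  rw [Ineq110]
  linarith

/-- **Cor. 1.2 (1.11), asymptotic form**: under RH, for all large `n`,
`log d(n)/log 2 ≤ li(log n) + β₂ li(log^{β₂} n)`. [cite: Nicolas2022HC, Cor. 1.2 (1.11)] -/
theorem ineq111_eventually_of_RH (hRH : RiemannHypothesis) : ∀ᶠ n : ℕ in atTop, Ineq111 n := by
  obtain ⟨hb0, _⟩ := beta_two_bounds
  obtain ⟨hb1, _⟩ := beta_two_bounds'
  have hb3 := beta_three_lt_half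
  filter_upwards [ineq18_eventually_of_RH hRH, tendsto_log_natCast.eventually_ge_atTop 2,
    tendsto_log_natCast.eventually ((tendsto_rpow_atTop (by linarith : 0 < beta 2 - beta 3)).eventually_ge_atTop 2)]
    with n h18 ht2 hpow
  set t := Real.log (n : ℝ) with ht
  have ht0 : 0 < t := by linarith
  have hlt : 0 < Real.log t := Real.log_pos (by linarith)
  have hR : 0 ≤ R t := by
    have := le_R_of_RH hRH ht0
    have hlam := nicolasBeta_lt'
    have : 0 ≤ (2 - nicolasBeta) * Real.sqrt t / Real.log t ^ 2 := by
      have : 0 < 2 - nicolasBeta := by linarith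
      positivity
    linarith
  have hW : 0 ≤ 5.12 * Real.sqrt t / Real.log t ^ 3 := by positivity
  -- `1.52 t^{β₃} ≤ t^{β₂}`
  have hb : 1.52 * t ^ beta 3 / Real.log t ≤ t ^ beta 2 / Real.log t := by
    gcongr
    have e : t ^ beta 2 = t ^ (beta 2 - beta 3) * t ^ beta 3 := by
      rw [← Real.rpow_add ht0]; ring_nf
    rw [e]
    have := mul_le_mul_of_nonneg_right hpow (Real.rpow_nonneg ht0.le (beta 3))
    have hz : 0 ≤ t ^ beta 3 := Real.rpow_nonneg ht0.le _
    linarith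
  rw [Ineq18, F] at h18
  rw [Ineq111]
  linarith

/-- **Cor. 1.2 (1.12), asymptotic form**: under RH, for all large `n`, `log d(n)/log 2 ≤ F(log n)`
(the paper: for `4324320 < n ≤ exp(10⁸)` or `n ≥ exp(1.56 × 10¹⁷)`).
[cite: Nicolas2022HC, Cor. 1.2 (1.12)] -/
theorem log2d_le_F_eventually_of_RH (hRH : RiemannHypothesis) :
    ∀ᶠ n : ℕ in atTop, log2d n ≤ F (Real.log n) := by
  have hb3 := beta_three_lt_half
  have hlam := nicolasBeta_lt'
  filter_upwards [ineq18_eventually_of_RH hRH, tendsto_log_natCast.eventually_ge_atTop 2,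
    tendsto_log_natCast.eventually (eventually_mul_log_pow_le_rpow' 1 1 (by linarith : 0 < 1 / 2 - beta 3))]
    with n h18 ht2 hsm
  set t := Real.log (n : ℝ) with ht
  have ht0 : 0 < t := by linarith
  have hlt : 0 < Real.log t := Real.log_pos (by linarith)
  have hR := le_R_of_RH hRH ht0
  have hW : 0 ≤ 5.12 * Real.sqrt t / Real.log t ^ 3 := by positivity
  -- `1.52 t^{β₃}/log t ≤ (2 − τ)√t/log² t`
  have e : Real.sqrt t = t ^ (1 / 2 - beta 3) * t ^ beta 3 := by
    rw [Real.sqrt_eq_rpow, ← Real.rpow_add ht0]; ring_nf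
  have key : 1.52 * t ^ beta 3 / Real.log t ≤ (2 - nicolasBeta) * Real.sqrt t / Real.log t ^ 2 := by
    rw [div_le_div_iff₀ hlt (pow_pos hlt 2), e]
    rw [pow_one, one_mul] at hsm
    have h1 := mul_le_mul_of_nonneg_right hsm (Real.rpow_nonneg ht0.le (beta 3))
    have h4 := mul_le_mul_of_nonneg_left h1 hlt.le
    have h5 : 0 ≤ t ^ (1 / 2 - beta 3) * t ^ beta 3 * Real.log t := by positivity
    have h6 := mul_le_mul_of_nonneg_right hlam.le h5
    nlinarith [h4, h5, h6]
  rw [Ineq18] at h18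
  linarith

/-- **Cor. 1.2 (1.13), asymptotic form**: under RH, for all large `n`,
`log d(n)/log 2 ≤ F(log n) − R(log n)` (the paper: for `N⁽¹⁾ < n < exp(10⁸)` or
`n > exp(1.11 × 10⁴⁰)`). [cite: Nicolas2022HC, Cor. 1.2 (1.13)] -/
theorem log2d_le_F_sub_R_eventually_of_RH (hRH : RiemannHypothesis) :
    ∀ᶠ n : ℕ in atTop, log2d n ≤ F (Real.log n) - R (Real.log n) := by
  have hb3 := beta_three_lt_half
  filter_upwards [ineq18_eventually_of_RH hRH, tendsto_log_natCast.eventually_ge_atTop 2,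
    tendsto_log_natCast.eventually (eventually_mul_log_pow_le_rpow' 1 2 (by linarith : 0 < 1 / 2 - beta 3))]
    with n h18 ht2 hsm
  set t := Real.log (n : ℝ) with ht
  have ht0 : 0 < t := by linarith
  have hlt : 0 < Real.log t := Real.log_pos (by linarith)
  have e : Real.sqrt t = t ^ (1 / 2 - beta 3) * t ^ beta 3 := by
    rw [Real.sqrt_eq_rpow, ← Real.rpow_add ht0]; ring_nf
  have key : 1.52 * t ^ beta 3 / Real.log t ≤ 5.12 * Real.sqrt t / Real.log t ^ 3 := by
    rw [div_le_div_iff₀ hlt (pow_pos hlt 3), e]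
    rw [one_mul] at hsm
    have h1 := mul_le_mul_of_nonneg_right hsm (Real.rpow_nonneg ht0.le (beta 3))
    have h4 := mul_le_mul_of_nonneg_left h1 hlt.le
    have h5 : 0 ≤ t ^ (1 / 2 - beta 3) * t ^ beta 3 * Real.log t := by positivity
    nlinarith [h4, h5]
  rw [Ineq18] at h18
  linarith

/-! ### §5. Kernel consequences: the equivalence over the fact (ii) alone -/

/-- **RH ⟺ (1.8) holds for all sufficiently large `n`, granted only the named fact (ii)**
(`Nicolas2022_thm_1_1_ii`: off RH, (1.8) fails infinitely often). The forward direction is the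
theorem `ineq18_eventually_of_RH` of this file, so — compared with the tree's
`riemannHypothesis_iff_eventually_of (h₁) (h₂)` — the fact (i) is no longer needed.
[cite: Nicolas2022HC, Thm. 1.1 (i)–(ii) ("(i) is equivalent to the Riemann hypothesis")] -/
theorem riemannHypothesis_iff_eventually_ineq18_of (h₂ : Nicolas2022_thm_1_1_ii) :
    RiemannHypothesis ↔ ∀ᶠ n : ℕ in atTop, Ineq18 n := by
  refine ⟨ineq18_eventually_of_RH, fun h ↦ ?_⟩
  by_contra hRH
  obtain ⟨N, hN⟩ := Filter.eventually_atTop.1 h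
  refine h₂ hRH ((Finset.finite_toSet (Finset.range N)).subset ?_)
  intro n hn
  simp only [Finset.coe_range, Set.mem_Iio]
  by_contra hlt
  exact hn (hN n (not_lt.1 hlt))

/-- **RH ⟺ the set of exceptions to (1.8) is finite, granted only the named fact (ii).**
[cite: Nicolas2022HC, Thm. 1.1 (i)–(ii)] -/
theorem riemannHypothesis_iff_setOf_not_ineq18_finite_of (h₂ : Nicolas2022_thm_1_1_ii) :
    RiemannHypothesis ↔ {n : ℕ | ¬ Ineq18 n}.Finite := by
  constructor
  · intro hRH
    obtain ⟨N, hN⟩ := Filter.eventually_atTop.1 (ineq18_eventually_of_RH hRH)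
    refine (Finset.finite_toSet (Finset.range N)).subset ?_
    intro n hn
    simp only [Finset.coe_range, Set.mem_Iio]
    by_contra hlt
    exact hn (hN n (not_lt.1 hlt))
  · intro hfin
    by_contra hRH
    exact h₂ hRH hfin

end Nicolas2022

end Literature.NumberTheory.LFunctions

end
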